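import Summits.QuantumFields.YangMills.Theorems.UnitScaleTiltHalvingP1FlatCoreSupplierInduction
import Literature.MathematicalPhysics.QuantumFieldTheory.Balaban1983to89.B8Eq142KLevelLocal
import Literature.MathematicalPhysics.QuantumFieldTheory.Balaban1983to89.B8Prop6OfThm4
import Literature.MathematicalPhysics.QuantumFieldTheory.Balaban1983to89.B8CubeMemberZd
import HarnessLib

/-!
# Line H (`BirthV10.stub_halvingStep`, stmt-QuantumFields-19200): ★★ THEOREM 4's INDUCTIVE (1.42) SOCKET (`hT4L`'s raw `H42`) CLOSED FROM J3's THREE ROWS —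
# lit ✓`B8Eq142KLevelLocal.H42_of_inAx` AT THE PER-SITE COMPOSERS' LETTERS (every truncation level `m ≤ K − n` carries the full (1.29) normalisation, so no top knit is needed)

Cell `ym3-torus` (HUMAN RULING D-0037: YM₃ on T³ is ladder rung R3 — NOT d = 4, NOT a mass gap, NOT the Clay problem), width seat `ym-ust-20520-w3` gen 7 (LEAD-H ★w5-19200 g5
FINAL 20:35:51Z: «`hT4L` (via its raw `H42` socket) OPEN at the top level»; v2 composers export J3's tower row (d)).  `--supports stmt-QuantumFields-19200 --as helper`; THEOREMS ONLY
(0 `def`, 0 `sorry`); count-neutral; nothing here claims `hMember`, `hSupUρ3`, the stub, the crux or the gap.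

THE POINT.  FILE A₂ ✓`HalvingHSiteDatumOfSockets.hT4_of_rawSockets` closes the Theorem-4 datum socket `hT4` of the `k ≥ 2` composer from four raw N05∕N06 sockets, among them
the INDUCTIVE (1.42) row `H42 : ∀ gJ, ∀ m, 1 ≤ m → m ≤ K − n → ∀ u W A′, …` (Theorem 4's hypothesis at every truncation level `m`, families `cubeLamS∕cubeLamB … (K − n) m`, FULL (1.29)
guard `Restr129 L m (cubeLamS … m) 1 u` at level `m`).  As displayed it is ∀ `gJ` with NO antecedent — uninhabitable for a wild gauge.  With J3's three rows for the SAME `gJ`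
((1.34)-𝔄 on `ℤᵈ`, the axial class for every family, the tower row (d) at every depth — ✓`HalvingP1FlatCorePreGaugeMember.exists_preGauge_chart_su` (a)(b′)(d), held by both composers)
inserted as antecedents it IS lit ✓`B8Eq142KLevelLocal.H42_of_inAx` at `U₀ := 1`, `Ω := cubeFam false L a M′ ρ′ (K−n)`, `Λs := cubeLamS …`, `Λb := cubeLamB …` — the member geometry by
lit ✓`B8CubeMemberZd.hΩ_cubeFam ∕ hbox_cubeLamB ∕ hclass_cubeLamB`, (1.33) by lit ✓`B8Prop6OfThm4.one_inAk`, (1.34)∕(Ax)∕(1.35) by ✓`HalvingP1FlatCoreSupplierInduction.h34_of_inAk_univ ∕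
hAx_of_inAx_one ∕ h135_cubeMember` (exactly as ✓`HalvingHSiteTopRowsOfSockets.siteTopRows_of_sockets` reads them).  ★★ `H42raw_of_tower`: that composition — the raw socket's
text with the three antecedents inserted, under the composer's Prop-3 windows.  HONEST SCOPE: one `exact`; nothing of Prop. 3∕4 or Theorem 4 of [Balaban1985RegularSpaces] is
proved here; the A₂ v2 that threads the antecedents is ★w3-19200's file, the pack texts LEAD-H's.

References: T. Bałaban, CMP **99** (1985) 75–102 [Balaban1985RegularSpaces] ((1.42) p.83, (1.29) p.81, (1.19) p.79, (1.35) p.82, Thm 4 p.88, (1.131) p.99); CMP **98** (1985) 17–51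
[Balaban1985Averaging] (Prop. 4 pp.38–39).
-/

set_option autoImplicit false

noncomputable section

open scoped BigOperators Matrix.Norms.L2Operator
open NormedSpace

namespace Summit.QuantumFields.YangMills.Theorems.HalvingHSiteRawH42OfTower

open Literature.MathematicalPhysics.QuantumFieldTheory.Balaban1983to89
open T4Continuum
open Literature.MathematicalPhysics.QuantumFieldTheory.Balaban1983to89.T3ContinuumYM3Torus
open B7Prop1Explicit renaming Site → LSite
open B7Prop1Explicit (e)
open B7Prop2Explicit (unitaryUnits C0 c2' avgIter)
open B7Prop3Flat (c3)
open B7Prop1Local (InBox loK bondHiK)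
open B7Eq92Concrete (mgauge)
open B8Ineq130 (tlo thi)
open B8Ineq132 (InAk)
open B8Eq119TwistedAxial (Restr129 InAx)
open B8Eq131Cubes (tLo tHi)
open B8Eq131CubesAdmissible (cubeFam)
open B8CubeMemberZd (cubeLamS cubeLamB hΩ_cubeFam hbox_cubeLamB hclass_cubeLamB)
open B8Eq184Proof (cfgExp)
open B8Eq140Level (SideTouches)
open B8Eq146AExpansion (iEta)
open B8Eq138LandauZd (IsLandau138W)
open B7Prop4GeneralLevels (logCovIter)
open B10Eq27TorusAxialLog (pull unitsField toUField)
open HalvingP1FlatCoreSupplierInduction (h34_of_inAk_univ hAx_of_inAx_one h135_cubeMember)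
open B8Prop6OfThm4 (one_inAk)
open B8Eq142KLevelLocal (H42_of_inAx)

variable (F : T3Family) {n K : ℕ}

/-- ★★ **THEOREM 4's INDUCTIVE (1.42) SOCKET FROM J3's THREE ROWS** — see the module docstring: the raw `H42` text of ✓`HalvingHSiteDatumOfSockets.hT4_of_rawSockets` with
`InAk`-on-`ℤᵈ`, `InAx`-for-every-family and the tower row (d) (at `α₁`) inserted after `gJ`, under the composer's Prop-3 windows (`α₂ := 2(L·c⋆) + 8α₄`) and `L ≤ ρ′`;
= lit ✓`B8Eq142KLevelLocal.H42_of_inAx` at the member. [cite: Balaban1985RegularSpaces, (1.42) p.83, (1.29) p.81, (1.19) p.79, (1.35) p.82, Thm 4 p.88, (1.131) p.99; Balaban1985Averaging, Prop. 4 pp.38-39] -/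
theorem H42raw_of_tower {a : LSite (F.P K).d} {M' ρ' : ℕ} (hρ' : (F.P K).L ≤ ρ')
    (U : GaugeField (F.P K) 0 (Matrix.specialUnitaryGroup (Fin 2) ℂ))
    {ε₀ α₁ cstar α₄ : ℝ} (hε₀ : 0 < ε₀) (hα₁ : 0 < α₁) (hα₂ : 0 ≤ 2 * ((F.P K).L * cstar) + 8 * α₄)
    (hα3 : C0 (F.P K).d * ε₀ ≤ 1 / 3) (hα4 : 4 * ε₀ ≤ c2' (F.P K).d (F.P K).L)
    (h16 : 16 * (2 * ((F.P K).L * cstar) + 8 * α₄) ≤ 1)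
    (hsmallP : Real.exp (4 * (800 * (((F.P K).d : ℝ) + 1) ^ 2 * (((F.P K).d : ℝ) + 4)) * ε₀)
      * (1 + 8 * (131072 * (((F.P K).d : ℝ) + 1) ^ 2) * (2 * ((F.P K).L * cstar) + 8 * α₄)) ≤ 2)
    (hc₃P : 2 * (2 * ((F.P K).L * cstar) + 8 * α₄) ≤ c3 (F.P K).d (F.P K).L) (hsmall₁ : ((F.P K).d : ℝ) * (F.P K).L * α₁ ≤ 1 / 8) :
    ∀ gJ : GaugeTransf (F.P K) 0 (Matrix.specialUnitaryGroup (Fin 2) ℂ),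
      -- NEW: J3 (a), (b′), (d) for this `gJ`
      InAk (F.P K).L (K - n) (((F.L : ℝ)⁻¹) ^ (K - n)) ε₀ (fun _ => (Set.univ : Set (LSite (F.P K).d))) (pull (unitsField (toUField (GaugeField.gaugeAct gJ U))) 0) →
      (∀ m', m' ≤ K - n → ∀ Λ : ℕ → Set (LSite (F.P K).d), InAx (F.P K).L m' Λ (1 : LSite (F.P K).d → Fin (F.P K).d → (Matrix (Fin 2) (Fin 2) ℂ)ˣ) (pull (unitsField (toUField (GaugeField.gaugeAct gJ U))) 0)) →
      (∀ m', m' ≤ K - n → ∀ (x : LSite (F.P K).d) (ν : Fin (F.P K).d), tlo (F.P K).L (tLo a ρ') m' ≤ x → x + e ν ≤ thi (F.P K).L (tHi a M' ρ') m' →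
        ‖((avgIter (F.P K).L (pull (unitsField (toUField (GaugeField.gaugeAct gJ U))) 0) (K - n - m') x ν : (Matrix (Fin 2) (Fin 2) ℂ)ˣ) :
            Matrix (Fin 2) (Fin 2) ℂ) - 1‖ < α₁) →
      -- the raw text of ✓`hT4_of_rawSockets`' `H42`
      ∀ m, 1 ≤ m → m ≤ K - n → ∀ (u : LSite (F.P K).d → (Matrix (Fin 2) (Fin 2) ℂ)ˣ) (W : LSite (F.P K).d → Fin (F.P K).d → (Matrix (Fin 2) (Fin 2) ℂ)ˣ) (A' : LSite (F.P K).d → Fin (F.P K).d → (Matrix (Fin 2) (Fin 2) ℂ)),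
      (∀ x, u x ∈ unitaryUnits (Matrix (Fin 2) (Fin 2) ℂ)) → mgauge (1 : LSite (F.P K).d → Fin (F.P K).d → (Matrix (Fin 2) (Fin 2) ℂ)ˣ) u W = (pull (unitsField (toUField (GaugeField.gaugeAct gJ U))) 0) → Restr129 (F.P K).L m ((cubeLamS (F.P K).L a M' ρ' (K - n)) m) (1 : LSite (F.P K).d → Fin (F.P K).d → (Matrix (Fin 2) (Fin 2) ℂ)ˣ) u → IsLandau138W (F.P K).L m (((F.L : ℝ)⁻¹) ^ (K - n)) ((cubeFam false (F.P K).L a M' ρ' (K - n)) 0) ((cubeLamS (F.P K).L a M' ρ' (K - n)) m) (1 : LSite (F.P K).d → Fin (F.P K).d → (Matrix (Fin 2) (Fin 2) ℂ)ˣ) W →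
      (∀ y τ, IsSelfAdjoint (A' y τ)) →
      (∀ j, j ≤ m → ∀ y τ, SideTouches ((cubeFam false (F.P K).L a M' ρ' (K - n)) j) y τ →
        W y τ = cfgExp (((F.L : ℝ)⁻¹) ^ (K - n)) A' y τ ∧ ‖A' y τ‖ ≤ (2 * ((F.P K).L * cstar) + 8 * α₄) * (((F.P K).L : ℝ) ^ j * (((F.L : ℝ)⁻¹) ^ (K - n)))⁻¹) →
      (∀ y τ, (∀ j, j ≤ m → ¬ SideTouches ((cubeFam false (F.P K).L a M' ρ' (K - n)) j) y τ) → A' y τ = 0) →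
      ∀ j, j ≤ m → ∀ c ∈ (cubeLamB (F.P K).L a M' ρ' (K - n)) m j, ‖logCovIter (F.P K).L (1 : LSite (F.P K).d → Fin (F.P K).d → (Matrix (Fin 2) (Fin 2) ℂ)ˣ) (iEta (((F.L : ℝ)⁻¹) ^ (K - n)) A') j c.1 c.2‖ < 2 * (F.P K).d * (F.P K).L * α₁ := by
  intro gJ hInAk hInAx htw m hm1 hmk u W A' hu hW h129 hLan hsa hsock hA0
  letI : CStarAlgebra (Matrix (Fin 2) (Fin 2) ℂ) := {}
  have hd2 : 2 ≤ (F.P K).d := by rw [T3Family.P_d]; norm_num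
  have hL2 : 2 ≤ (F.P K).L := by have := F.hL.2; exact this
  have hL1 : 1 ≤ (F.P K).L := (F.P K).L_pos
  have hρ'1 : 1 ≤ ρ' := hL1.trans hρ'
  have hL0 : (0 : ℝ) < (F.L : ℝ) := by have := F.hL.2; exact_mod_cast (by omega : 0 < F.L)
  have hη : (0 : ℝ) < ((F.L : ℝ)⁻¹) ^ (K - n) := pow_pos (inv_pos.2 hL0) _
  have hU₀ : ∀ (x : LSite (F.P K).d) (κ : Fin (F.P K).d),
      (1 : LSite (F.P K).d → Fin (F.P K).d → (Matrix (Fin 2) (Fin 2) ℂ)ˣ) x κ ∈ unitaryUnits (Matrix (Fin 2) (Fin 2) ℂ) :=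
    fun _ _ => (unitaryUnits (Matrix (Fin 2) (Fin 2) ℂ)).one_mem
  exact H42_of_inAx hd2 hη hL2 (K - n) hU₀ hε₀ hα₁ hα₂ hα3 hα4 h16 hsmallP hc₃P hsmall₁
    (cubeFam false (F.P K).L a M' ρ' (K - n)) (hΩ_cubeFam (d := (F.P K).d) hL1 a M' hρ' (K - n))
    (cubeLamS (F.P K).L a M' ρ' (K - n)) (cubeLamB (F.P K).L a M' ρ' (K - n))
    (hbox_cubeLamB (d := (F.P K).d) (F.P K).L a M' ρ' (K - n)) (hclass_cubeLamB (d := (F.P K).d) (F.P K).L a M' ρ' (K - n))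
    (one_inAk hL1 (K - n) hη hε₀ _) (h34_of_inAk_univ hInAk _) (hAx_of_inAx_one hInAx _) (h135_cubeMember (𝔸 := Matrix (Fin 2) (Fin 2) ℂ) hL2 a M' hρ'1 htw)
    (fun m W => IsLandau138W (F.P K).L m (((F.L : ℝ)⁻¹) ^ (K - n)) ((cubeFam false (F.P K).L a M' ρ' (K - n)) 0) ((cubeLamS (F.P K).L a M' ρ' (K - n)) m)
      (1 : LSite (F.P K).d → Fin (F.P K).d → (Matrix (Fin 2) (Fin 2) ℂ)ˣ) W)
    m hm1 hmk u W A' hu hW h129 hLan hsa hsock hA0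

end Summit.QuantumFields.YangMills.Theorems.HalvingHSiteRawH42OfTower

end
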